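import Mathlib
import Literature.MathematicalPhysics.QuantumFieldTheory.Balaban1983to89.B6
import Literature.MathematicalPhysics.QuantumFieldTheory.Balaban1983to89.B5QGGQ145Bounds

/-!
# `Balaban1983to89.B6Prop23OneScaleTorus` — T. Bałaban, *Propagators and renormalization transformations for lattice
gauge theories. II*, Commun. Math. Phys. **96** (1984) 223–250 [Balaban1984PropagatorsII]: **Proposition 2.3 (2.87) —
the VERBATIM census typing `B6.Prop23Printed` INHABITED WITH NO HYPOTHESIS on the ONE-SCALE TORUS FAMILY by the GENUINE
kernel of `(Q′_kG′_k²Q′_k*)⁻¹`**, constants uniform in the scale `k` (mesh `η = L^{−k}`), in the torus and in `M`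

statement-level skeleton of published theorems with citation tags; proofs where landed; nothing here is a claim about the Yang–Mills mass gap.
PDF held: `paper:balaban1984-cmp96-propagators-rt-ii` (journal page = PDF page + 222); pp. 235–238 [PDF 13–16] read this
session (`lit read paper:balaban1984-cmp96-propagators-rt-ii --pages 13-16`; the verbatim statement of Proposition 2.3
is the docstring of `B6.Prop23Printed`, certified against the ×2 renders by the B6 block reader r03).

CITATION HEADER (cell `lit-balaban`, Phase-2 proof seat `p01` (gen 5) = unit `lit-balaban-p01`, HOME
`run/shared/lean/pub/lit-balaban/`, `PHASE2-TARGETS.md` §G, free-target protocol G.5-34(d)); SKELETON row **`B6.Prop2.3`**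
(kind «model-instance»: the verbatim Prop `B6.Prop23Printed` of `…B6`, so far inhabited only by CONSTANT ∕ DIAGONAL kernels —
`B6Ineq288Edge.prop23Printed_unit`, `B6Prop23Printed` (pt), `B6Prop23TwoLevel` (δ-kernel), `B6TowerPrinted.prop23Printed_
diagonalTowerFamily` — is inhabited here by the operator the Proposition is ABOUT).  Imported, not modified: `…B6`
(`B6.Geometry`, `B6.SiteKernel`, `B6.Prop23Printed`; cell pub-balaban b2b) and `…B5QGGQ145Bounds` (cell pub-balaban, unit
b2b-balaban-b05: the real matrices `qggqRe` = `Q′_kG′_k²Q′_k*` and `kerRe` = its inverse on the unit torus `Π_μ ℤ/N_μ`, with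
`kerRe_mul_qggqRe`, `qggqRe_mul_kerRe`, `qggqRe_inv`, `coercive_qggqRe`; through it `…B5QGGQ145Torus` — `qggq_eq_blockAvg`:
the matrix IS `Q′∘G′∘G′∘Q′*` with `G′ = (Δ^η + aQ′_k*Q′_k)⁻¹` on the fine torus `Π_μ ℤ/(L^kN_μ)` — and `…B5Torus145Decay` —
`inverse145_torusKernelM_decay_torusMetric`: the k- and volume-uniform exponential decay of the inverse kernel, and
`…B4TorusKernel` — the torus sup-distance `MultiPeriod.torusSupNorm`, `circAbs`, `periodConst`).

WHAT THE PAPER PRINTS.  p. 238 [PDF 16], Proposition 2.3, verbatim (= docstring of `B6.Prop23Printed`): *"An inverse of the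
operator Q′G′²Q′* is given by the convergent expansion (Q′G′²Q′*)⁻¹ = C(I − R)⁻¹ = Σ_{n=0}^∞ CRⁿ = … (2.86) and it satisfies
the estimate |(Q′G′²Q′*)⁻¹(y, y′)| ≤ O(1)(L^jη)^{−4}(L^{j′}η)^{−d}e^{−½δ₁d(y,y′)} y, y′ ∈ 𝔅, y ∈ Λ_j, y′ ∈ Λ_{j′}. (2.87)"*;
p. 235 [PDF 13]: *"Of course the operator Q′G′²Q′* is positive definite, so its inverse is well defined. We will construct it
and investigate its properties using again a random walk expansion. Our considerations are analogous to Sect. 5 of [3],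
concerning unit lattice operators. If we have one scale, i.e. Λ_k = T₁^{(k)}, then the operator is a unit lattice
operator."*; (2.69) p. 235: *"⟨λ,λ′⟩ = Σ_{j=0}^k Σ_{y∈Λ_j} (L^jη)^d λ(y)λ′(y)"*; (2.46) p. 231: *"d(y, y′) =
inf_{Γ_{y,y′}} Σ_{j=0}^{k} (L^jη)^{−1}|Γ_{y,y′} ∩ B^j(Λ_j)|"* with *"a part of Γ contained in B^j(Λ_j) consists of bonds of the
lattice Λ_j"*; (2.13) p. 225: *"Δ′_a = Δ + Q′*aQ′"*; Proposition 2.2 p. 234: *"G′ = Δ′_a^{−1} (a = 1)"*.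

THE ONE-SCALE TORUS FAMILY (the reading, stated once).  ONE scale: `Λ_k = T₁^{(k)}` = the unit torus `Π_μ ℤ/N_μ`
(`B5QGGQ145Bounds.Idx N`, period vector `N`, `N_μ ≥ 1`), all sites at scale `j = k`, `η = L^{−k}`, so `L^jη = 1` for every
site (`oneScaleTorusGeo_len`) and the pairing (2.69) is the plain sum `Σ_y λ(y)λ′(y)`; the fine torus is `T_η = Π_μ ℤ/(L^kN_μ)`;
`Q′ = Q′_k` = the block average over the blocks `B^k(y)` of `L^{k(d+1)}` fine sites, `Q′*` its adjoint for (2.69) ∕ `Σ_x η^d`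
(block-constant extension); `Δ′_a = Δ^η + aQ′_k*Q′_k` ((2.13) with one level), `G′ = Δ′_a⁻¹`; the admissible contours of
(2.46) on one scale are chains of unit-torus bonds, so `d(y, y′)` = the periodic ℓ¹ (graph) distance `torusL1` of §1;
(2.1)–(2.2) are void on one level (`Hyp21_22 := True`, as in `B6LevelTower.twGeo`).  The coefficient `a` ranges over an
arbitrary window `[a₋, a₊]`, `a₋ > 0` (Proposition 2.2 fixes a = 1; the running a_j of (2.13)–(2.14) stay in such a window),
and the dimension is written `d + 1` (Lean) for the paper's `d ≥ 1`.  THE KERNEL: `torusCinv … y y′ = kerRe (L^k) a N y y′ =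
(Q′_kG′_k²Q′_k*)⁻¹(y, y′)`, the (y, y′) entry of the INVERSE MATRIX of `qggqRe (L^k) a N` (`torusCinv_eq_inv`; two-sided
inverse `torusCinv_mul_qggq`, `qggq_mul_torusCinv`), `qggqRe` being the matrix of the operator `Q′_kG′_k²Q′_k*` in the point
basis of `T₁^{(k)}` (`B5QGGQ145Torus.qggq_eq_blockAvg`).

WHAT IS PROVED HERE (0 sorry, 0 named facts; axioms standard).
§1 `torusL1` — the periodic ℓ¹ distance on `Π_μ ℤ/N_μ` (private helper `torusL1_le_mul_torusSupNorm`: `|x|₁ ≤ (d+1)|x|_∞` on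
  the torus).
§2 `oneScaleTorusGeo d L k N M R` (the `B6.Geometry` above, HONEST readings of every abstract field: `Loc`/`Cut` = functions on
  the fine torus, `suppIn λ y′` = supp λ ⊂ B^k(y′), `supNorm` = sup norm, `l2Norm` = (Σ_x η^{d+1}λ(x)²)^{1/2}, `holder` = the
  Hölder seminorm for the fine periodic ℓ¹ distance scaled by η, `cutH α ζ = ‖ζ‖_α + |ζ|`), `oneScaleTorusGeo_len` (L^jη = 1),
  `torusCinv` (the `B6.SiteKernel` of (Q′_kG′_k²Q′_k*)⁻¹), `torusCinv_eq_inv`, `torusCinv_mul_qggq`, `qggq_mul_torusCinv`.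
§3 **`ineq287_oneScaleTorus`** — (2.87) on the family with explicit structure of the constants: there are `δ₁, C > 0`
  (depending on d and the window only) with `|(Q′_kG′_k²Q′_k*)⁻¹(y,y′)| ≤ C·e^{−½δ₁·d(y,y′)}` for EVERY k, every period vector,
  every a ∈ [a₋, a₊]; **`prop23Printed_oneScaleTorus`** — `B6.Prop23Printed (d+1) (oneScaleTorusGeo-family) (torusCinv-family)`
  with witnesses `M₁ = 1`, `δ₁`, `C`, i.e. THE VERBATIM PROPOSITION 2.3 HOLDS ON THE ONE-SCALE TORUS FAMILY WITH NO ANALYTIC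
  HYPOTHESIS; `oneScaleTorus_meets_hypotheses` (non-vacuity: every member satisfies (2.1)–(2.2) and, for M ≥ 1, the
  threshold; members exist for every k, N, M, R, a).
ROUTE ∕ HONEST SCOPE (declared deviations).  (i) ONE scale only (the verbatim multi-scale Proposition — several levels Λ_j, the
metric (2.46) across levels, the prefactors (L^jη)^{−4}(L^{j′}η)^{−d} with j ≠ j′ — is the DAG hypothesis of the cell and is
NOT touched); scalar fields (U = 1), as everywhere in [B6] Sect. B.  (ii) The decay is obtained by the route the tree proves
for [B5] (1.45) ∕ (1.126): the multiplier (1.45) of Q′_kG′_k²Q′_k* on the torus, its analytic continuation to a strip and the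
periodisation (`B5Torus145Decay`), i.e. the *"analyticity method"* of [3] = [Balaban1983RegularityDecay] that p. 237 names as
the alternative (*"Another way to prove it is to consider the operator e^{⟨a,·⟩}Q′G′^ξ(□̃)²Q′*e^{−⟨a,·⟩} …"*), NOT by the
random-walk expansion (2.82)–(2.86) (whose one-scale content is the same estimate); the expansion clause (2.86) of the
Proposition is not part of the census typing `B6.Prop23Printed` and is not asserted here.  (iii) Constants (δ₁, C) are
existential (those of `B5Torus145Decay.inverse145_torusKernelM_decay_torusMetric` and `B4TorusKernel.periodConst`), depending
on d and the window [a₋, a₊] only — uniform in k, N, M, R: this uniformity in the scale is the content of the one-scale case.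
(iv) The k = 0 member (η = 1, blocks = sites, Q′ = I) is the degenerate case (G′²)⁻¹ = (Δ′_a)² of this seat's gen-3/4 box
family; the members k ≥ 1 are genuine two-grid operators.  (v) `M`, `R` are carried as family parameters with no constraint
(on one level there are no big-block conditions (2.1)–(2.2)); the torus periods N_μ are arbitrary ≥ 1.
-/

namespace Literature.MathematicalPhysics.QuantumFieldTheory.Balaban1983to89.B6Prop23OneScaleTorus

open Finset Matrix
open B4TorusKernel (periodConst)
open B4TorusKernel.MultiPeriod (circAbs torusSupNorm)
open B5Torus145Decay (torusKernel145M inverse145_torusKernelM_decay_torusMetric)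
open B5QGGQ145Bounds (Idx toZ kerRe qggqRe kerRe_mul_qggqRe qggqRe_mul_kerRe qggqRe_inv)

noncomputable section

variable {d : ℕ}

/-! ## §1. The periodic ℓ¹ distance on the unit torus `Π_μ ℤ/N_μ` = the one-scale distance (2.46) -/

/-- The periodic ℓ¹ distance of the class of `x` to `0` on `Π_μ ℤ/N_μ`: `Σ_μ dist(x_μ, N_μℤ)` — on ONE scale the admissible
contours of (2.46) are chains of unit-torus bonds and `(L^kη)⁻¹|Γ| =` their number, so `d(y, y′) = torusL1 N (y − y′)` (the
graph distance of the unit torus). [cite: Balaban1984PropagatorsII, (2.46) p.231] -/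
def torusL1 (N : Fin (d + 1) → ℕ) (x : Fin (d + 1) → ℤ) : ℝ :=
  ∑ i, ((circAbs (N i) (x i) : ℤ) : ℝ)

/-- `|x|₁ ≤ (d+1)·|x|_∞` on the torus `Π_μ ℤ/N_μ`: the periodic ℓ¹ distance is at most `d + 1` times the periodic
sup-distance `MultiPeriod.torusSupNorm`. [folklore] -/
private theorem torusL1_le_mul_torusSupNorm (N : Fin (d + 1) → ℕ) (x : Fin (d + 1) → ℤ) :
    torusL1 N x ≤ (d + 1) * torusSupNorm N x := by
  unfold torusL1 torusSupNorm
  have h : ∀ i ∈ (Finset.univ : Finset (Fin (d + 1))),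
      ((circAbs (N i) (x i) : ℤ) : ℝ) ≤
        Finset.univ.sup' Finset.univ_nonempty (fun i => ((circAbs (N i) (x i) : ℤ) : ℝ)) :=
    fun i hi => Finset.le_sup' (fun i => ((circAbs (N i) (x i) : ℤ) : ℝ)) hi
  calc ∑ i, ((circAbs (N i) (x i) : ℤ) : ℝ)
      ≤ ∑ _i : Fin (d + 1), Finset.univ.sup' Finset.univ_nonempty (fun i => ((circAbs (N i) (x i) : ℤ) : ℝ)) :=
        Finset.sum_le_sum h
    _ = (d + 1) * Finset.univ.sup' Finset.univ_nonempty (fun i => ((circAbs (N i) (x i) : ℤ) : ℝ)) := by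
        rw [Finset.sum_const, Finset.card_univ, Fintype.card_fin, nsmul_eq_mul]
        push_cast
        ring

/-! ## §2. The one-scale torus family: the geometry with honest readings and the kernel of `(Q′_kG′_k²Q′_k*)⁻¹` -/

section Family

variable (d) (L : ℕ) [NeZero L]

/-- The sites of the fine torus `T_η = Π_μ ℤ/(L^kN_μ)` (η = L^{−k}): `Π_μ Fin (L^kN_μ)`. [cite: Balaban1984PropagatorsII, (2.1) p.224] -/
abbrev FineIdx (k : ℕ) (N : Fin (d + 1) → ℕ+) : Type := Idx (fun i => L ^ k * (N i : ℕ))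

/-- The block map `x ↦ y` with `x ∈ B^k(y)`: fine site ↦ unit-torus site (integer division of each coordinate by L^k).
[cite: Balaban1984PropagatorsII, (2.1) p.224] -/
def blockOf (k : ℕ) (N : Fin (d + 1) → ℕ+) (x : FineIdx d L k N) : Idx (fun i => (N i : ℕ)) :=
  fun i => ⟨(x i : ℕ) / L ^ k, Nat.div_lt_of_lt_mul (x i).isLt⟩

/-- The Hölder seminorm `‖f‖_α = sup_{x ≠ x′} |f(x) − f(x′)|/(η|x − x′|₁)^α` of a function on the fine torus (periodic ℓ¹
distance in lattice units times the mesh η = L^{−k}; the pair x = x′ contributes 0). [cite: Balaban1984PropagatorsII, (2.67) p.234] -/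
def holderT (k : ℕ) (N : Fin (d + 1) → ℕ+) (α : ℝ) (f : FineIdx d L k N → ℝ) : ℝ :=
  ⨆ p : FineIdx d L k N × FineIdx d L k N,
    |f p.1 - f p.2| / ((((L : ℝ) ^ k)⁻¹ * torusL1 (fun i => L ^ k * (N i : ℕ)) (toZ p.1 - toZ p.2)) ^ α)

/-- **The one-scale torus geometry** `Λ_k = T₁^{(k)} = Π_μ ℤ/N_μ` as a `B6.Geometry`, with HONEST readings of every
abstract field: sites = the unit torus (`Idx N`), every site at scale k, η = L^{−k} (so L^jη = 1), d = the periodic ℓ¹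
distance (2.46) on one scale, R and M carried as parameters (no (2.1)–(2.2) condition on one level: `Hyp21_22 := True`),
`Loc` = functions λ on the fine torus with `suppIn λ y′` = supp λ ⊂ B^k(y′), `supNorm` = |λ| = sup norm, `l2Norm` =
(Σ_x η^{d+1}λ(x)²)^{1/2}, `holder` = `holderT`, `Cut` = cut-offs ζ on the fine torus, `cutIn ζ y` = supp ζ ⊂ B^k(y),
`cutH α ζ` = ‖ζ‖_α + |ζ|, `cutSup ζ` = |ζ|. [cite: Balaban1984PropagatorsII, (2.1)–(2.4) p.224, (2.46) p.231, p.235] -/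
@[reducible] def oneScaleTorusGeo (k : ℕ) (N : Fin (d + 1) → ℕ+) (M R : ℕ) : B6.Geometry where
  Site := Idx (fun i => (N i : ℕ))
  fin := inferInstance
  scale := fun _ => k
  dist := fun y y' => torusL1 (fun i => (N i : ℕ)) (toZ y - toZ y')
  k := k
  eta := ((L : ℝ) ^ k)⁻¹
  L := L
  R := R
  M := M
  Hyp21_22 := True
  Loc := FineIdx d L k N → ℝ
  suppIn := fun lam y' => ∀ x, blockOf d L k N x ≠ y' → lam x = 0
  supNorm := fun lam => ‖lam‖
  l2Norm := fun lam => Real.sqrt (∑ x, ((L : ℝ) ^ k)⁻¹ ^ (d + 1) * lam x ^ 2)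
  holder := fun α lam => holderT d L k N α lam
  Cut := FineIdx d L k N → ℝ
  cutIn := fun ζ y => ∀ x, blockOf d L k N x ≠ y → ζ x = 0
  cutH := fun α ζ => holderT d L k N α ζ + ‖ζ‖
  cutSup := fun ζ => ‖ζ‖

/-- L^jη = 1 on the one-scale torus: every site of Λ_k = T₁^{(k)} is at scale k and η = L^{−k} (*"If we have one scale … the
operator is a unit lattice operator"*). [cite: Balaban1984PropagatorsII, p.235] -/
@[simp] theorem oneScaleTorusGeo_len (k : ℕ) (N : Fin (d + 1) → ℕ+) (M R : ℕ)
    (y : (oneScaleTorusGeo d L k N M R).Site) : (oneScaleTorusGeo d L k N M R).len y = 1 := by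
  have hL : ((L : ℕ) : ℝ) ≠ 0 := Nat.cast_ne_zero.mpr (NeZero.ne L)
  simp [B6.Geometry.len, hL]

/-- **The kernel of `(Q′_kG′_k²Q′_k*)⁻¹` on the one-scale torus** in the pairing (2.69) (unit weights (L^kη)^d = 1): the
entries of the real matrix `B5QGGQ145Bounds.kerRe (L^k) a N` = the inverse matrix of `qggqRe (L^k) a N` = the matrix of
`Q′_kG′_k²Q′_k*`, `G′_k = (Δ^η + aQ′_k*Q′_k)⁻¹`, η = L^{−k}. [cite: Balaban1984PropagatorsII, Prop. 2.3 (2.87) p.238] -/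
def torusCinv (k : ℕ) (N : Fin (d + 1) → ℕ+) (M R : ℕ) (a : ℝ) : B6.SiteKernel (oneScaleTorusGeo d L k N M R) :=
  ⟨fun y y' => kerRe (L ^ k) a (fun i => (N i : ℕ)) y y'⟩

variable {L}

/-- `1 ≤ L^k` for `L ≠ 0`. [folklore] -/
private theorem one_le_pow_L (k : ℕ) : 1 ≤ L ^ k := Nat.one_le_pow k L (Nat.pos_of_ne_zero (NeZero.ne L))

/-- **The kernel IS the inverse**: `torusCinv = (Q′_kG′_k²Q′_k*)⁻¹` entrywise, i.e. the entries of the inverse matrix of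
`qggqRe (L^k) a N` (*"the operator Q′G′²Q′* is positive definite, so its inverse is well defined"*).
[cite: Balaban1984PropagatorsII, p.235] -/
theorem torusCinv_eq_inv (k : ℕ) (N : Fin (d + 1) → ℕ+) (M R : ℕ) {a : ℝ} (ha : 0 < a)
    (y y' : (oneScaleTorusGeo d L k N M R).Site) :
    (torusCinv d L k N M R a).ker y y' = (qggqRe (L ^ k) a (fun i => (N i : ℕ)))⁻¹ y y' := by
  show kerRe (L ^ k) a (fun i => (N i : ℕ)) y y' = _
  rw [qggqRe_inv (L ^ k) (one_le_pow_L k) a ha (fun i => (N i).pos)]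

/-- `Σ_{y′} (Q′_kG′_k²Q′_k*)⁻¹(y, y′)·(Q′_kG′_k²Q′_k*)(y′, y″) = δ_{yy″}` (left inverse, pairing (2.69) with unit weights).
[cite: Balaban1984PropagatorsII, p.235] -/
theorem torusCinv_mul_qggq (k : ℕ) (N : Fin (d + 1) → ℕ+) (M R : ℕ) {a : ℝ} (ha : 0 < a)
    (y y'' : (oneScaleTorusGeo d L k N M R).Site) :
    ∑ y', (torusCinv d L k N M R a).ker y y' * qggqRe (L ^ k) a (fun i => (N i : ℕ)) y' y'' =
      if y = y'' then 1 else 0 := by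
  have h := congrFun (congrFun (kerRe_mul_qggqRe (L ^ k) (one_le_pow_L k) a ha (fun i => (N i).pos)) y) y''
  rw [Matrix.mul_apply, Matrix.one_apply] at h
  exact h

/-- `Σ_{y′} (Q′_kG′_k²Q′_k*)(y, y′)·(Q′_kG′_k²Q′_k*)⁻¹(y′, y″) = δ_{yy″}` (right inverse). [cite: Balaban1984PropagatorsII, p.235] -/
theorem qggq_mul_torusCinv (k : ℕ) (N : Fin (d + 1) → ℕ+) (M R : ℕ) {a : ℝ} (ha : 0 < a)
    (y y'' : (oneScaleTorusGeo d L k N M R).Site) :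
    ∑ y', qggqRe (L ^ k) a (fun i => (N i : ℕ)) y y' * (torusCinv d L k N M R a).ker y' y'' =
      if y = y'' then 1 else 0 := by
  have h := congrFun (congrFun (qggqRe_mul_kerRe (L ^ k) (one_le_pow_L k) a ha (fun i => (N i).pos)) y) y''
  rw [Matrix.mul_apply, Matrix.one_apply] at h
  exact h

end Family

/-! ## §3. (2.87) on the one-scale torus family and the verbatim Proposition 2.3 -/

section Prop23

variable (d) (L : ℕ) [NeZero L]

/-- The index of the one-scale torus family: the scale k (mesh η = L^{−k}), the period vector N of the unit torus
`T₁^{(k)} = Π_μ ℤ/N_μ`, the parameters M, R, and the coefficient a ∈ [a₋, a₊] of Δ′_a = Δ^η + aQ′_k*Q′_k.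
[cite: Balaban1984PropagatorsII, (2.1)–(2.2) p.224, (2.13) p.225] -/
structure Index (aminus aplus : ℝ) where
  k : ℕ
  N : Fin (d + 1) → ℕ+
  M : ℕ
  R : ℕ
  a : ℝ
  a_mem : aminus ≤ a ∧ a ≤ aplus

/-- `0 < periodConst κ d` for `κ > 0`. [folklore] -/
private theorem periodConst_pos {κ : ℝ} (hκ : 0 < κ) (d : ℕ) : 0 < periodConst κ d := by
  unfold periodConst
  have h1 : 0 < κ / (d + 1) := div_pos hκ (by positivity)
  have h2 : Real.exp (-(κ / (d + 1))) < 1 := Real.exp_lt_one_iff.mpr (by linarith)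
  have h3 : 0 < 1 - Real.exp (-(κ / (d + 1))) := by linarith
  positivity

/-- **(2.87) on the one-scale torus family, uniformly**: there are `δ₁ > 0` and `C > 0`, depending on d and the window
[a₋, a₊] only, such that for EVERY scale k (mesh η = L^{−k}), every period vector N (N_μ ≥ 1), every M, R and every
a ∈ [a₋, a₊]: `|(Q′_kG′_k²Q′_k*)⁻¹(y, y′)| ≤ C·e^{−½δ₁·d(y,y′)}` for all y, y′ ∈ T₁^{(k)} — the printed (2.87) with
L^jη = L^{j′}η = 1.  Mechanism: `B5Torus145Decay.inverse145_torusKernelM_decay_torusMetric` (decay in the periodic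
sup-distance, rate κ/(d+1)) and `torusL1 ≤ (d+1)·torusSupNorm` (δ₁ = 2κ/(d+1)²). [cite: Balaban1984PropagatorsII, Prop. 2.3 (2.87) p.238] -/
theorem ineq287_oneScaleTorus {aminus aplus : ℝ} (ha : 0 < aminus) :
    ∃ δ₁ C : ℝ, 0 < δ₁ ∧ 0 < C ∧ ∀ i : Index d aminus aplus,
      ∀ y y' : (oneScaleTorusGeo d L i.k i.N i.M i.R).Site,
        |(torusCinv d L i.k i.N i.M i.R i.a).ker y y'| ≤
          C * Real.exp (-(δ₁ / 2 * (oneScaleTorusGeo d L i.k i.N i.M i.R).dist y y')) := by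
  obtain ⟨κ, c, hκ, hc, hdec⟩ := inverse145_torusKernelM_decay_torusMetric d aminus aplus ha
  have hd1 : (0 : ℝ) < (d : ℝ) + 1 := by positivity
  refine ⟨2 * κ / (((d : ℝ) + 1) * ((d : ℝ) + 1)), c⁻¹ * periodConst κ d, by positivity,
    mul_pos (inv_pos.mpr hc) (periodConst_pos hκ d), fun i y y' => ?_⟩
  have hN : ∀ μ, 1 ≤ (fun μ => (i.N μ : ℕ)) μ := fun μ => (i.N μ).pos
  -- the B5 bound in the periodic sup-distance
  have hB := hdec (L ^ i.k) i.a i.a_mem.1 i.a_mem.2 (fun μ => (i.N μ : ℕ)) hN (toZ y - toZ y')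
  -- |re z| ≤ ‖z‖
  have hre : |(torusCinv d L i.k i.N i.M i.R i.a).ker y y'| ≤
      ‖torusKernel145M (L ^ i.k) i.a (fun μ => (i.N μ : ℕ)) (toZ y - toZ y')‖ := by
    show |(kerRe (L ^ i.k) i.a (fun μ => (i.N μ : ℕ))) y y'| ≤ _
    unfold kerRe
    rw [Matrix.of_apply]
    exact Complex.abs_re_le_norm _
  -- comparison of the exponents: κ/(d+1)·|x|_∞ ≥ (δ₁/2)·|x|₁
  have hcmp : Real.exp (-(κ / (d + 1) * torusSupNorm (fun μ => (i.N μ : ℕ)) (toZ y - toZ y'))) ≤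
      Real.exp (-(2 * κ / (((d : ℝ) + 1) * ((d : ℝ) + 1)) / 2 *
        (oneScaleTorusGeo d L i.k i.N i.M i.R).dist y y')) := by
    apply Real.exp_le_exp.mpr
    have h1 := torusL1_le_mul_torusSupNorm (fun μ => (i.N μ : ℕ)) (toZ y - toZ y')
    show -(κ / (d + 1) * torusSupNorm (fun μ => (i.N μ : ℕ)) (toZ y - toZ y')) ≤
      -(2 * κ / (((d : ℝ) + 1) * ((d : ℝ) + 1)) / 2 * torusL1 (fun μ => (i.N μ : ℕ)) (toZ y - toZ y'))
    have h2 : 2 * κ / (((d : ℝ) + 1) * ((d : ℝ) + 1)) / 2 * torusL1 (fun μ => (i.N μ : ℕ)) (toZ y - toZ y')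
        = κ / (d + 1) * (torusL1 (fun μ => (i.N μ : ℕ)) (toZ y - toZ y') / (d + 1)) := by
      field_simp
    rw [h2, neg_le_neg_iff]
    refine mul_le_mul_of_nonneg_left ?_ (div_nonneg hκ.le hd1.le)
    rw [div_le_iff₀ hd1]
    linarith
  calc |(torusCinv d L i.k i.N i.M i.R i.a).ker y y'|
      ≤ ‖torusKernel145M (L ^ i.k) i.a (fun μ => (i.N μ : ℕ)) (toZ y - toZ y')‖ := hre
    _ ≤ c⁻¹ * periodConst κ d *
          Real.exp (-(κ / (d + 1) * torusSupNorm (fun μ => (i.N μ : ℕ)) (toZ y - toZ y'))) := hB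
    _ ≤ c⁻¹ * periodConst κ d * Real.exp (-(2 * κ / (((d : ℝ) + 1) * ((d : ℝ) + 1)) / 2 *
          (oneScaleTorusGeo d L i.k i.N i.M i.R).dist y y')) :=
        mul_le_mul_of_nonneg_left hcmp (mul_pos (inv_pos.mpr hc) (periodConst_pos hκ d)).le

/-- **PROPOSITION 2.3, VERBATIM (`B6.Prop23Printed`), ON THE ONE-SCALE TORUS FAMILY WITH NO HYPOTHESIS**: for every
dimension d + 1, every L ≥ 1 and every window [a₋, a₊] (a₋ > 0), the census Prop holds for the family of all one-scale tori
`Λ_k = T₁^{(k)} = Π_μ ℤ/N_μ` (all scales k, all periods N_μ ≥ 1, all M, R, all a ∈ [a₋, a₊]) with the kernels of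
`(Q′_kG′_k²Q′_k*)⁻¹`, `G′_k = (Δ^η + aQ′_k*Q′_k)⁻¹` — witnesses M₁ = 1, δ₁, O(1) = C of `ineq287_oneScaleTorus`
((L^jη)^{−4}(L^{j′}η)^{−d} = 1 on one scale). [cite: Balaban1984PropagatorsII, Prop. 2.3 (2.86)–(2.87) p.238] -/
theorem prop23Printed_oneScaleTorus {aminus aplus : ℝ} (ha : 0 < aminus) :
    B6.Prop23Printed (d + 1) (fun i : Index d aminus aplus => oneScaleTorusGeo d L i.k i.N i.M i.R)
      (fun i => torusCinv d L i.k i.N i.M i.R i.a) := by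
  obtain ⟨δ₁, C, hδ₁, hC, h⟩ := ineq287_oneScaleTorus d L ha
  refine ⟨1, δ₁, C, one_pos, hδ₁, hC, fun i _ _ y y' => ?_⟩
  rw [oneScaleTorusGeo_len, oneScaleTorusGeo_len, Real.one_rpow, Real.one_rpow, mul_one, mul_one]
  exact h i y y'

omit [NeZero L] in
/-- **Non-vacuity**: every member of the family satisfies the hypotheses of `B6.Prop23Printed` with the witness M₁ = 1
as soon as M ≥ 1 ((2.1)–(2.2) hold — they are void on one scale — and M₁ ≤ M), and the family has a member for every
scale k, every period vector N, every M ≥ 1, every R and every a in the window; so the conclusion (2.87) is asserted for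
all of them, not vacuously. [cite: Balaban1984PropagatorsII, Prop. 2.3 p.238] -/
theorem oneScaleTorus_meets_hypotheses {aminus aplus : ℝ} (hwin : aminus ≤ aplus) (k : ℕ) (N : Fin (d + 1) → ℕ+)
    (M R : ℕ) (hM : 1 ≤ M) :
    ∃ i : Index d aminus aplus, i.k = k ∧ i.N = N ∧ i.M = M ∧ i.R = R ∧
      (oneScaleTorusGeo d L i.k i.N i.M i.R).Hyp21_22 ∧ (1 : ℝ) ≤ (oneScaleTorusGeo d L i.k i.N i.M i.R).M :=
  ⟨⟨k, N, M, R, aminus, le_rfl, hwin⟩, rfl, rfl, rfl, rfl, trivial, by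
    show (1 : ℝ) ≤ ((M : ℕ) : ℝ)
    exact_mod_cast hM⟩

end Prop23

end

end Literature.MathematicalPhysics.QuantumFieldTheory.Balaban1983to89.B6Prop23OneScaleTorus
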